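/-
Copyright: the b2b-balaban T⁴-continuum CRUX team, row NE7b OWNER lineage `t4-ne7b-p1` (gen 127). Project licence.
-/
import Summits.QuantumFields.BalabanUV.T4Continuum.Spine.NE7b.SupFibreFiniteRangeRemainder

/-!
# NO SCALE CARRIES MORE THAN THE WHOLE: every piece `Γ_N` and the last-scale piece `Γ_J^{rem}` of (273)∕(278)'s decomposition of the
# fluctuation covariance `C` is dominated by `C` in the Loewner order (the other summands are positive semidefinite), `C` itself is
# bounded as a form by the inverse floor (`0 ≤ fᵀCf ≤ m⁻¹Σf²`, the fibre equation + the floor `m`), and a symmetric positive semidefinite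
# kernel with form bound `K` has ENTRIES bounded by `K`; so `|Γ_N(x,y)|, |Γ_J^{rem}(x,y)|, |C(x,y)| ≤ 1∕m` — uniformly in the scale, the
# mesh, the chart and the volume: the a-priori size every scale-by-scale bookkeeping starts from (row NE7b, node U5c; (271)∕(273)∕(278) BY
# NAME; [folklore])

Cell `pub-balaban`, sub-cell `t4`, spine estimate NE7b (`T4WeightBudget.RelWeightBound`; the cell's OWN estimate — NOT PRINTED in
[Bałaban 1983–89], NOT PROVED).  Crux-route work under `Spine/NE7b/` by the row OWNER (`t4-ne7b-p1` gen 127, file (283)) under FREEZE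
(0)'s crux-prover clause, on § [NE7bP1-G126-HANDOFF] NEXT (3)(d), at TEA's level; NOTHING of Bałaban's is named as a Lean object, valued or
asserted; no `T4Continuum/Support` leaf typed; no `def`, no notation; zero `sorry`.  Imports (BY NAME): the OWNER's (278)
`…SupFibreFiniteRangeRemainder` (`inv_mul_frdRemainder_posSemidef`; through it (273) `inverse_frd`, `pushforward_posSemidef`,
`pushforward_add`, `pushforward_smul_sum`, `scaled_isHermitian`, (271) `chart_posDef`, `covariance_mem_fibre`, `covariance_fibre_equation`,
`form_chart_eq`); the tree's `posSemidef_frdPiece`; Mathlib's `Finset.inner_mul_le_norm_mul_norm`-free Cauchy–Schwarz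
`Finset.sum_mul_sq_le_sq_mul_sq`.

WHY (located).  (273)∕(278)∕(280) give the STRUCTURE of the finite-range route (psd pieces, finite ranges, convolution of scales); every
quantitative step after it (Dobrushin∕KP thresholds for the scale-`N` polymer gas, (282)) needs SIZES.  The sharp single-shell scaling
`‖C_N‖ = O(4^{−N})` is spectral (the tree's Fejér symbol bound on eigenvectors) and is left to a successor; the bound here is the
order-theoretic one that costs nothing: a summand of a positive decomposition is below the sum, and the sum is below `m⁻¹`.

WHAT IS PROVED ([folklore]; `ι`, `σ` finite; then (273)'s data with floor `m > 0`):
* §1 `entry_le_of_form_le` (a symmetric kernel with `0 ≤ fᵀΓf ≤ KΣf²` for all `f` has `|Γ(x,y)| ≤ K`), `pushforward_symm`,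
  `form_eq_dotProduct`, `pushforward_form_nonneg` ((273)'s `pushforward_posSemidef` read as a form).
* §2 **`covariance_form_le`** (`0 ≤ Σ_{xy} f_xC(x,y)f_y ≤ m⁻¹Σf²` for `C = PM_z⁻¹Pᵀ`).
* §3 `covariance_form_split`, **`piece_form_le`**, **`remainder_form_le`** (`0 ≤ fᵀΓ_Nf ≤ fᵀCf` for `N < J`, `0 ≤ fᵀΓ_J^{rem}f ≤ fᵀCf`).
* §4 THE END **`frd_entries_le`** (`|C(x,y)| ≤ m⁻¹`, `|Γ_N(x,y)| ≤ m⁻¹` for `N < J`, `|Γ_J^{rem}(x,y)| ≤ m⁻¹`); §5 toy.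

HONEST (what this is NOT).  Order bookkeeping; NOT the single-shell decay in `N` (spectral, successor); the torus reading is (281)'s objects
with `m = min(2,a) − λ`; scalar skeleton ((A3), NC-NE7b-α UNRULED); nothing of Bałaban's asserted.  BY-NAME EFFECT ON THE WALL: NONE.  NE7b NOT
PRINTED ∕ NOT PROVED; spine PROVED 0∕9; rung (B)+1 — the programme's measures remain FINITE-torus statements; NOT the mass gap, NOT Clay.
HONEST DEPENDENCY: continuum YM on T⁴ ⇐ BetaPertH ∧ nine spine estimates (0∕9 proved); BetaPertH ⇐ (D1) ∧ (D4) ∧ CAP+tail; G-an2-4 gates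
asym, D1 and NE2∕3∕4.
-/

set_option autoImplicit false

noncomputable section

namespace Summit.QuantumFields.BalabanUV.T4Continuum.NE7b.SupFibreFiniteRangePieceBound

open Matrix
open Literature.Analysis.Matrix (frdPiece frdRemainder posSemidef_frdPiece)
open SupFibreGaussianCovariance (chart_posDef covariance_mem_fibre covariance_fibre_equation form_chart_eq chart_transpose_eq)
open SupFibreFiniteRangeDecomposition (inverse_frd pushforward_posSemidef pushforward_add pushforward_smul_sum scaled_isHermitian
  pushforward_eq_mul)
open SupFibreFiniteRangeRemainder (inv_mul_frdRemainder_posSemidef)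

variable {ι : Type*} [Fintype ι] {σ : Type} [Fintype σ] [DecidableEq σ]
  {H : (ι → ℝ) →L[ℝ] (ι → ℝ) →L[ℝ] ℝ} {m p ΛH q : ℝ} (P : (σ → ℝ) →L[ℝ] (ι → ℝ))

/-! ## §1. Entries of a symmetric kernel from its form bound; the pushforward form -/

omit [Fintype σ] [DecidableEq σ] in
/-- **ENTRIES FROM THE FORM**: a symmetric kernel on a finite carrier with `0 ≤ Σ_{xy} f_xΓ(x,y)f_y ≤ K·Σf²` for every `f` has `|Γ(x,y)| ≤ K`.
[folklore] -/
theorem entry_le_of_form_le (Γ : ι → ι → ℝ) (hsymm : ∀ x y, Γ x y = Γ y x) {K : ℝ}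
    (hnn : ∀ f : ι → ℝ, 0 ≤ ∑ x, ∑ y, f x * Γ x y * f y) (hle : ∀ f : ι → ℝ, ∑ x, ∑ y, f x * Γ x y * f y ≤ K * ∑ x, f x ^ 2)
    (x y : ι) : |Γ x y| ≤ K := by
  classical
  -- the test fields `w_{αβ} = α·e_x + β·e_y`
  obtain ⟨w, hw⟩ : ∃ w : ℝ → ℝ → ι → ℝ, ∀ α β u, w α β u = α * (if u = x then 1 else 0) + β * (if u = y then 1 else 0) :=
    ⟨fun α β u => α * (if u = x then 1 else 0) + β * (if u = y then 1 else 0), fun _ _ _ => rfl⟩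
  have hrow : ∀ (g : ι → ℝ) (α β : ℝ), ∑ v, g v * w α β v = α * g x + β * g y := fun g α β => by
    have e : ∀ v, g v * w α β v = α * (if v = x then g v else 0) + β * (if v = y then g v else 0) := fun v => by
      rw [hw]; split_ifs <;> ring
    simp only [e, Finset.sum_add_distrib, ← Finset.mul_sum, Finset.sum_ite_eq', Finset.mem_univ, if_true]
  have hform : ∀ α β, ∑ u, ∑ v, w α β u * Γ u v * w α β v = α ^ 2 * Γ x x + α * β * Γ x y + α * β * Γ y x + β ^ 2 * Γ y y := by
    intro α β
    have h1 : ∀ u, ∑ v, w α β u * Γ u v * w α β v = (α * Γ u x + β * Γ u y) * w α β u := fun u => by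
      rw [← hrow (Γ u) α β, Finset.sum_mul]
      exact Finset.sum_congr rfl fun v _ => by ring
    simp only [h1]
    rw [hrow (fun u => α * Γ u x + β * Γ u y) α β]
    ring
  have hsq : ∀ α, ∑ u, w α 0 u ^ 2 = α ^ 2 ∧ ∑ u, w 0 α u ^ 2 = α ^ 2 := fun α => by
    have e1 : ∀ u, w α 0 u ^ 2 = α ^ 2 * (if u = x then 1 else 0) := fun u => by rw [hw]; split_ifs <;> ring
    have e2 : ∀ u, w 0 α u ^ 2 = α ^ 2 * (if u = y then 1 else 0) := fun u => by rw [hw]; split_ifs <;> ring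
    simp only [e1, e2, ← Finset.mul_sum, Finset.sum_ite_eq', Finset.mem_univ, if_true, mul_one, and_self]
  -- diagonal bounds and the two sign combinations
  have hxx := hle (w 1 0)
  have hxx0 := hnn (w 1 0)
  have hyy := hle (w 0 1)
  have hp := hnn (w 1 1)
  have hm' := hnn (w 1 (-1))
  rw [hform] at hxx hxx0 hyy hp hm'
  rw [(hsq 1).1] at hxx
  rw [(hsq 1).2] at hyy
  rw [hsymm y x] at hp hm'
  rw [abs_le]
  constructor <;> nlinarith

omit [Fintype ι] in
/-- The pushforward of a symmetric chart matrix is a symmetric field kernel. [folklore] -/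
theorem pushforward_symm {D : Matrix σ σ ℝ} (hD : Dᵀ = D) (x y : ι) :
    (∑ j, ∑ k, P (Pi.single j 1) x * D j k * P (Pi.single k 1) y) = ∑ j, ∑ k, P (Pi.single j 1) y * D j k * P (Pi.single k 1) x := by
  rw [Finset.sum_comm]
  refine Finset.sum_congr rfl fun k _ => Finset.sum_congr rfl fun j _ => ?_
  rw [show D j k = D k j from by rw [← transpose_apply D j k, hD]]
  ring

omit [Fintype σ] [DecidableEq σ] in
/-- A double-sum form is the `dotProduct`–`mulVec` form of the kernel's matrix. [folklore] -/
theorem form_eq_dotProduct (Γ : ι → ι → ℝ) (f : ι → ℝ) :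
    ∑ x, ∑ y, f x * Γ x y * f y = f ⬝ᵥ (Matrix.of fun x y => Γ x y) *ᵥ f := by
  simp only [dotProduct, mulVec, of_apply, Finset.mul_sum]
  exact Finset.sum_congr rfl fun x _ => Finset.sum_congr rfl fun y _ => by ring

/-- The pushforward form of a positive semidefinite chart matrix is nonnegative ((273)'s `pushforward_posSemidef`). [folklore] -/
theorem pushforward_form_nonneg {D : Matrix σ σ ℝ} (hD : D.PosSemidef) (f : ι → ℝ) :
    0 ≤ ∑ x, ∑ y, f x * (∑ j, ∑ k, P (Pi.single j 1) x * D j k * P (Pi.single k 1) y) * f y := by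
  rw [form_eq_dotProduct]
  have h := (pushforward_posSemidef P hD).dotProduct_mulVec_nonneg f
  rwa [star_trivial] at h

/-! ## §2. The whole covariance is bounded by the inverse floor -/

/-- **`0 ≤ fᵀCf ≤ m⁻¹Σf²`** for `C = PM_z⁻¹Pᵀ`: `H` symmetric with floor `m > 0`, chart bound `p > 0`. [folklore] -/
theorem covariance_form_le (hHsym : ∀ h k : ι → ℝ, H h k = H k h) (hfl : ∀ h : ι → ℝ, m * ∑ x, h x ^ 2 ≤ H h h) (hm : 0 < m)
    (hP : ∀ z : σ → ℝ, p * ∑ i, z i ^ 2 ≤ ∑ x, P z x ^ 2) (hp : 0 < p) (Mz : Matrix σ σ ℝ)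
    (hMz : ∀ j k, Mz j k = H (P (Pi.single j 1)) (P (Pi.single k 1))) (f : ι → ℝ) :
    0 ≤ ∑ x, ∑ y, f x * (∑ j, ∑ k, P (Pi.single j 1) x * Mz⁻¹ j k * P (Pi.single k 1) y) * f y ∧
    ∑ x, ∑ y, f x * (∑ j, ∑ k, P (Pi.single j 1) x * Mz⁻¹ j k * P (Pi.single k 1) y) * f y ≤ m⁻¹ * ∑ x, f x ^ 2 := by
  have hpd := chart_posDef P hHsym hfl hm hP hp Mz hMz
  refine ⟨pushforward_form_nonneg P hpd.inv.posSemidef f, ?_⟩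
  -- `u = Cf = P w` and `H u u = Σ f u`
  obtain ⟨u, hu⟩ : ∃ u : ι → ℝ, u = fun x => ∑ y, (∑ j, ∑ k, P (Pi.single j 1) x * Mz⁻¹ j k * P (Pi.single k 1) y) * f y :=
    ⟨_, rfl⟩
  have hform : ∑ x, ∑ y, f x * (∑ j, ∑ k, P (Pi.single j 1) x * Mz⁻¹ j k * P (Pi.single k 1) y) * f y = ∑ x, f x * u x := by
    rw [hu]
    refine Finset.sum_congr rfl fun x _ => ?_
    rw [Finset.mul_sum _ _ (f x)]
    exact Finset.sum_congr rfl fun y _ => by ring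
  have hw := covariance_mem_fibre P Mz f
  rw [← hu] at hw
  have hHuu : H u u = ∑ x, f x * u x := by
    have h := covariance_fibre_equation P hHsym hfl hm hP hp Mz hMz f (Mz⁻¹ *ᵥ fun k => ∑ y, P (Pi.single k 1) y * f y)
    rw [← hu, hw] at h
    exact h
  -- floor + Cauchy–Schwarz
  have h1 : m * ∑ x, u x ^ 2 ≤ ∑ x, f x * u x := by rw [← hHuu]; exact hfl u
  have hcs : (∑ x, f x * u x) ^ 2 ≤ (∑ x, f x ^ 2) * ∑ x, u x ^ 2 := Finset.sum_mul_sq_le_sq_mul_sq Finset.univ f u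
  have hF : 0 ≤ ∑ x, f x ^ 2 := Finset.sum_nonneg fun x _ => sq_nonneg _
  have hU : 0 ≤ ∑ x, u x ^ 2 := Finset.sum_nonneg fun x _ => sq_nonneg _
  rw [hform]
  have hS : 0 ≤ ∑ x, f x * u x := le_trans (mul_nonneg hm.le hU) h1
  -- `mS² ≤ F·(mU) ≤ F·S`, so `S ≤ F∕m`
  have key : (∑ x, f x * u x) * m * (∑ x, f x * u x) ≤ (∑ x, f x ^ 2) * ∑ x, f x * u x :=
    calc (∑ x, f x * u x) * m * (∑ x, f x * u x) = m * (∑ x, f x * u x) ^ 2 := by ring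
      _ ≤ m * ((∑ x, f x ^ 2) * ∑ x, u x ^ 2) := mul_le_mul_of_nonneg_left hcs hm.le
      _ = (∑ x, f x ^ 2) * (m * ∑ x, u x ^ 2) := by ring
      _ ≤ (∑ x, f x ^ 2) * ∑ x, f x * u x := mul_le_mul_of_nonneg_left h1 hF
  rw [← div_eq_inv_mul, le_div_iff₀ hm]
  rcases hS.eq_or_lt with h0 | hpos
  · rw [← h0, zero_mul]; exact hF
  · exact le_of_mul_le_mul_right key hpos

/-! ## §3. Every summand of the decomposition is below the whole -/

/-- **THE FORM SPLITS ALONG THE DECOMPOSITION**: `fᵀCf = Σ_{N<J} fᵀΓ_Nf + fᵀΓ_J^{rem}f`. [folklore] -/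
theorem covariance_form_split (hHsym : ∀ h k : ι → ℝ, H h k = H k h) (hfl : ∀ h : ι → ℝ, m * ∑ x, h x ^ 2 ≤ H h h) (hm : 0 < m)
    (hP : ∀ z : σ → ℝ, p * ∑ i, z i ^ 2 ≤ ∑ x, P z x ^ 2) (hp : 0 < p) (Mz : Matrix σ σ ℝ)
    (hMz : ∀ j k, Mz j k = H (P (Pi.single j 1)) (P (Pi.single k 1))) (c : ℝ) (J : ℕ) (f : ι → ℝ) :
    ∑ x, ∑ y, f x * (∑ j, ∑ k, P (Pi.single j 1) x * Mz⁻¹ j k * P (Pi.single k 1) y) * f y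
      = (∑ N ∈ Finset.range J, ∑ x, ∑ y, f x * (∑ j, ∑ k, P (Pi.single j 1) x * (c • frdPiece (c • Mz) N) j k * P (Pi.single k 1) y) * f y)
        + ∑ x, ∑ y, f x * (∑ j, ∑ k, P (Pi.single j 1) x * (Mz⁻¹ * frdRemainder (c • Mz) J) j k * P (Pi.single k 1) y) * f y := by
  have hdec : ∀ x y, (∑ j, ∑ k, P (Pi.single j 1) x * Mz⁻¹ j k * P (Pi.single k 1) y)
      = (∑ N ∈ Finset.range J, ∑ j, ∑ k, P (Pi.single j 1) x * (c • frdPiece (c • Mz) N) j k * P (Pi.single k 1) y)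
        + ∑ j, ∑ k, P (Pi.single j 1) x * (Mz⁻¹ * frdRemainder (c • Mz) J) j k * P (Pi.single k 1) y := fun x y => by
    conv_lhs => rw [inverse_frd P hHsym hfl hm hP hp Mz hMz c J]
    rw [pushforward_add P, pushforward_smul_sum P]
  have h1 : ∀ x y, f x * (∑ j, ∑ k, P (Pi.single j 1) x * Mz⁻¹ j k * P (Pi.single k 1) y) * f y
      = (∑ N ∈ Finset.range J, f x * (∑ j, ∑ k, P (Pi.single j 1) x * (c • frdPiece (c • Mz) N) j k * P (Pi.single k 1) y) * f y)
        + f x * (∑ j, ∑ k, P (Pi.single j 1) x * (Mz⁻¹ * frdRemainder (c • Mz) J) j k * P (Pi.single k 1) y) * f y := by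
    intro x y
    rw [hdec, mul_add, add_mul, Finset.mul_sum _ _ (f x), Finset.sum_mul]
  simp only [h1, Finset.sum_add_distrib]
  congr 1
  -- `Σ_x Σ_y Σ_N = Σ_N Σ_x Σ_y`
  symm
  rw [Finset.sum_comm]
  exact Finset.sum_congr rfl fun x _ => Finset.sum_comm

/-- **EACH FINITE-RANGE PIECE IS BELOW THE WHOLE**: for (273)'s data and `N < J`, `0 ≤ fᵀΓ_Nf ≤ fᵀCf`. [folklore] -/
theorem piece_form_le (hHsym : ∀ h k : ι → ℝ, H h k = H k h) (hfl : ∀ h : ι → ℝ, m * ∑ x, h x ^ 2 ≤ H h h) (hm : 0 < m)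
    (hceil : ∀ h : ι → ℝ, H h h ≤ ΛH * ∑ x, h x ^ 2) (hΛH : 0 < ΛH)
    (hP : ∀ z : σ → ℝ, p * ∑ i, z i ^ 2 ≤ ∑ x, P z x ^ 2) (hp : 0 < p) (hPceil : ∀ z : σ → ℝ, ∑ x, P z x ^ 2 ≤ q * ∑ i, z i ^ 2)
    (hq : 0 < q) (Mz : Matrix σ σ ℝ) (hMz : ∀ j k, Mz j k = H (P (Pi.single j 1)) (P (Pi.single k 1))) {J N : ℕ} (hN : N < J)
    (f : ι → ℝ) :
    0 ≤ ∑ x, ∑ y, f x * (∑ j, ∑ k, P (Pi.single j 1) x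
        * ((4 / (ΛH * q)) • frdPiece ((4 / (ΛH * q)) • Mz) N) j k * P (Pi.single k 1) y) * f y ∧
    ∑ x, ∑ y, f x * (∑ j, ∑ k, P (Pi.single j 1) x
        * ((4 / (ΛH * q)) • frdPiece ((4 / (ΛH * q)) • Mz) N) j k * P (Pi.single k 1) y) * f y
      ≤ ∑ x, ∑ y, f x * (∑ j, ∑ k, P (Pi.single j 1) x * Mz⁻¹ j k * P (Pi.single k 1) y) * f y := by
  have hc : (0 : ℝ) ≤ 4 / (ΛH * q) := by positivity
  have hAH := scaled_isHermitian P hHsym Mz hMz (4 / (ΛH * q))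
  have hpc : ∀ N', 0 ≤ ∑ x, ∑ y, f x * (∑ j, ∑ k, P (Pi.single j 1) x
      * ((4 / (ΛH * q)) • frdPiece ((4 / (ΛH * q)) • Mz) N') j k * P (Pi.single k 1) y) * f y := fun N' =>
    pushforward_form_nonneg P ((posSemidef_frdPiece hAH N').smul hc) f
  have hrem := pushforward_form_nonneg P (inv_mul_frdRemainder_posSemidef P hHsym hfl hm hceil hΛH hP hp hPceil hq Mz hMz J) f
  refine ⟨hpc N, ?_⟩
  rw [covariance_form_split P hHsym hfl hm hP hp Mz hMz (4 / (ΛH * q)) J f]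
  have hsingle := Finset.single_le_sum (f := fun N' => ∑ x, ∑ y, f x * (∑ j, ∑ k, P (Pi.single j 1) x
      * ((4 / (ΛH * q)) • frdPiece ((4 / (ΛH * q)) • Mz) N') j k * P (Pi.single k 1) y) * f y)
    (fun N' _ => hpc N') (Finset.mem_range.2 hN)
  linarith

/-- **THE LAST-SCALE PIECE IS BELOW THE WHOLE**: `0 ≤ fᵀΓ_J^{rem}f ≤ fᵀCf`. [folklore] -/
theorem remainder_form_le (hHsym : ∀ h k : ι → ℝ, H h k = H k h) (hfl : ∀ h : ι → ℝ, m * ∑ x, h x ^ 2 ≤ H h h) (hm : 0 < m)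
    (hceil : ∀ h : ι → ℝ, H h h ≤ ΛH * ∑ x, h x ^ 2) (hΛH : 0 < ΛH)
    (hP : ∀ z : σ → ℝ, p * ∑ i, z i ^ 2 ≤ ∑ x, P z x ^ 2) (hp : 0 < p) (hPceil : ∀ z : σ → ℝ, ∑ x, P z x ^ 2 ≤ q * ∑ i, z i ^ 2)
    (hq : 0 < q) (Mz : Matrix σ σ ℝ) (hMz : ∀ j k, Mz j k = H (P (Pi.single j 1)) (P (Pi.single k 1))) (J : ℕ) (f : ι → ℝ) :
    0 ≤ ∑ x, ∑ y, f x * (∑ j, ∑ k, P (Pi.single j 1) x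
        * (Mz⁻¹ * frdRemainder ((4 / (ΛH * q)) • Mz) J) j k * P (Pi.single k 1) y) * f y ∧
    ∑ x, ∑ y, f x * (∑ j, ∑ k, P (Pi.single j 1) x
        * (Mz⁻¹ * frdRemainder ((4 / (ΛH * q)) • Mz) J) j k * P (Pi.single k 1) y) * f y
      ≤ ∑ x, ∑ y, f x * (∑ j, ∑ k, P (Pi.single j 1) x * Mz⁻¹ j k * P (Pi.single k 1) y) * f y := by
  have hc : (0 : ℝ) ≤ 4 / (ΛH * q) := by positivity
  have hAH := scaled_isHermitian P hHsym Mz hMz (4 / (ΛH * q))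
  have hpc : ∀ N', 0 ≤ ∑ x, ∑ y, f x * (∑ j, ∑ k, P (Pi.single j 1) x
      * ((4 / (ΛH * q)) • frdPiece ((4 / (ΛH * q)) • Mz) N') j k * P (Pi.single k 1) y) * f y := fun N' =>
    pushforward_form_nonneg P ((posSemidef_frdPiece hAH N').smul hc) f
  have hrem := pushforward_form_nonneg P (inv_mul_frdRemainder_posSemidef P hHsym hfl hm hceil hΛH hP hp hPceil hq Mz hMz J) f
  refine ⟨hrem, ?_⟩
  rw [covariance_form_split P hHsym hfl hm hP hp Mz hMz (4 / (ΛH * q)) J f]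
  have hsum := Finset.sum_nonneg fun N' (_ : N' ∈ Finset.range J) => hpc N'
  linarith

/-! ## §4. THE END: uniform entry bounds -/

/-- **HEADLINE — NO SCALE CARRIES MORE THAN THE WHOLE, AND THE WHOLE IS AT MOST `m⁻¹`.**  For (273)'s data (`H` symmetric with floor
`m > 0` and ceiling `Λ_H > 0`, chart bound `p > 0` and ceiling `q > 0`, `M_z(j,k) = H(Pe_j)(Pe_k)`, `c = 4∕(Λ_Hq)`), every `J` and every `N < J`:
`|C(x,y)| ≤ m⁻¹`, `|Γ_N(x,y)| ≤ m⁻¹`, `|Γ_J^{rem}(x,y)| ≤ m⁻¹` for all field sites `x, y` — uniformly in the scale, the mesh, the chart and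
the volume. [folklore] -/
theorem frd_entries_le (hHsym : ∀ h k : ι → ℝ, H h k = H k h) (hfl : ∀ h : ι → ℝ, m * ∑ x, h x ^ 2 ≤ H h h) (hm : 0 < m)
    (hceil : ∀ h : ι → ℝ, H h h ≤ ΛH * ∑ x, h x ^ 2) (hΛH : 0 < ΛH)
    (hP : ∀ z : σ → ℝ, p * ∑ i, z i ^ 2 ≤ ∑ x, P z x ^ 2) (hp : 0 < p) (hPceil : ∀ z : σ → ℝ, ∑ x, P z x ^ 2 ≤ q * ∑ i, z i ^ 2)
    (hq : 0 < q) (Mz : Matrix σ σ ℝ) (hMz : ∀ j k, Mz j k = H (P (Pi.single j 1)) (P (Pi.single k 1))) {J N : ℕ} (hN : N < J)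
    (x y : ι) :
    |∑ j, ∑ k, P (Pi.single j 1) x * Mz⁻¹ j k * P (Pi.single k 1) y| ≤ m⁻¹ ∧
    |∑ j, ∑ k, P (Pi.single j 1) x * ((4 / (ΛH * q)) • frdPiece ((4 / (ΛH * q)) • Mz) N) j k * P (Pi.single k 1) y| ≤ m⁻¹ ∧
    |∑ j, ∑ k, P (Pi.single j 1) x * (Mz⁻¹ * frdRemainder ((4 / (ΛH * q)) • Mz) J) j k * P (Pi.single k 1) y| ≤ m⁻¹ := by
  have hpd := chart_posDef P hHsym hfl hm hP hp Mz hMz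
  have hc : (0 : ℝ) ≤ 4 / (ΛH * q) := by positivity
  have hAH := scaled_isHermitian P hHsym Mz hMz (4 / (ΛH * q))
  -- symmetry of the three chart matrices (positive semidefinite real matrices are symmetric)
  have hsymm_of : ∀ {D : Matrix σ σ ℝ}, D.PosSemidef → Dᵀ = D := fun hD => by
    have h := hD.isHermitian
    rwa [IsHermitian, conjTranspose_eq_transpose_of_trivial] at h
  have hC := covariance_form_le P hHsym hfl hm hP hp Mz hMz
  refine ⟨?_, ?_, ?_⟩
  · exact entry_le_of_form_le _ (pushforward_symm P (hsymm_of hpd.inv.posSemidef)) (fun f => (hC f).1) (fun f => (hC f).2) x y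
  · refine entry_le_of_form_le _ (pushforward_symm P (hsymm_of ((posSemidef_frdPiece hAH N).smul hc))) (fun f => ?_) (fun f => ?_) x y
    · exact (piece_form_le P hHsym hfl hm hceil hΛH hP hp hPceil hq Mz hMz hN f).1
    · exact (piece_form_le P hHsym hfl hm hceil hΛH hP hp hPceil hq Mz hMz hN f).2.trans (hC f).2
  · refine entry_le_of_form_le _ (pushforward_symm P
      (hsymm_of (inv_mul_frdRemainder_posSemidef P hHsym hfl hm hceil hΛH hP hp hPceil hq Mz hMz J))) (fun f => ?_) (fun f => ?_) x y
    · exact (remainder_form_le P hHsym hfl hm hceil hΛH hP hp hPceil hq Mz hMz J f).1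
    · exact (remainder_form_le P hHsym hfl hm hceil hΛH hP hp hPceil hq Mz hMz J f).2.trans (hC f).2

/-! ## §5. Toy -/

/-- Toy: a symmetric kernel on one site with form `Γ·f²`, `0 ≤ Γ ≤ K`, has its entry below `K` (§1's lemma at `ι = Fin 1`). -/
example (Γ K : ℝ) (h0 : 0 ≤ Γ) (hK : Γ ≤ K) : |(fun _ _ : Fin 1 => Γ) 0 0| ≤ K :=
  entry_le_of_form_le (fun _ _ : Fin 1 => Γ) (fun _ _ => rfl)
    (fun f => by simp only [Finset.univ_unique, Fin.default_eq_zero, Finset.sum_singleton]; nlinarith [sq_nonneg (f 0)])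
    (fun f => by simp only [Finset.univ_unique, Fin.default_eq_zero, Finset.sum_singleton]; nlinarith [sq_nonneg (f 0)]) 0 0

end Summit.QuantumFields.BalabanUV.T4Continuum.NE7b.SupFibreFiniteRangePieceBound
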